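import Literature.NumberTheory.EllipticCurves.TowerSaturatedCartesianPresentedProofs
import HarnessLib

/-!
# The residual image of a saturated level condition is read INSIDE one level by a torsion cut
# (pure tower algebra; theorems only — no definition, no named fact, no instance, no `sorry`)

`Proofs` file in the currency of the tree's abstract towers `Literature.NumberTheory.EllipticCurves.Tower.*`
(`compatibleFamilies`, `saturatedFamilies`, `levelCondition`; Kőnig in constraint form
`exists_mem_compatibleFamilies_of_forall_mem`).  Cell `pub/bsd-print-x9`, brick (H5B-P-ANOM) of `Stmt.h5bAtS` (Howard's
hypothesis H.5(b) at the places `v ∣ p` for the Eisenstein specialisation `T_𝔮 = T_p E ⊗ Λ/(T^m + p)(ψ)`), road «uniform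
involution»: B. Howard, *The Heegner point Kolyvagin system*, Compositio Math. 140 (2004), H.5(b) (arXiv:1202.6340 p. 7
L96–97), Def. 3.1.2 (p. 15 L99–108: `F_𝔮` at `v ∣ p` is `H¹_ord` PROPAGATED from `V_𝔮`, i.e. the SATURATION of the strict
ordinary cores), Lemma 3.2.7 (p. 16: the saturation is controlled by the torsion `H⁰(K_v, gr_v A_𝔮)`).

THE STATEMENT (`Tower.map_levelCondition_eq_map_torsionCut`).  Two towers of abelian groups `H`, `G` (intended:
`H_j = H¹(K_v, T/π^j T)`, `G_j = H¹(K_v, gr_v (T/π^j T))`), each presented by a two-index additive family `fH a b`,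
`fG a b` whose one-step maps `f (j+1) j` are the reductions (only `b ≤ a` is used), a levelwise projection
`pr_j : H_j → G_j` commuting with the families, commuting levelwise endomorphisms `πH_j`, `πG_j` («multiplication by the
uniformiser `π = [T]`»), the cores `C_j = ker pr_j` (the STRICT ordinary condition) and natural numbers `r, c, c', N` with
`r + c + c' + 1 ≤ N`.  HYPOTHESES (each discharged cohomologically elsewhere): (hπ1) `πH_1 = 0` (`T/πT` is killed by
`π`); (hTor) a compatible family of `G` killed by a power of `p` is killed levelwise by `π^r` (the torsion of
`lim H¹(K_v, gr T)` has exponent `π^r`: no `Γ_{K_v}`-invariants of `gr (T/π^d)` survive `π^r`, Howard's control index);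
(hSat) a compatible family `x` with `π^r pr x = 0` is `p`-saturated for the cores (`p ∈ π^r S_𝔮`); (hE) EXACTNESS: a
compatible family of `G` vanishing at level `k` is `π^k` times a compatible family from level `k` on (tree
`Tower.exists_forall_map_eq_of_apply_eq_zero`); (hF2) every `π^c w`, `w ∈ G_j`, is a `pr_j z` (`π^c` kills the
obstruction group `H²(K_v, Fil_v)`); (hLift) every `y ∈ H_N` agrees below level `N - c'` with a compatible family (`π^{c'}`
kills `H²(K_v, T/π^i)`).  CONCLUSION:

  `(levelCondition red p C N).map (fH N 1) = {y ∈ H_N | π^r (pr_N y) = 0}.map (fH N 1)`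

— the image of the saturated (= propagated-from-`V`) condition in the residual cohomology `H_1` is the image of the
«torsion cut» `{π^r · pr y = 0}`, a condition read inside the single level `N`.  PROOF: `⊆` is (hTor); for `⊇`, lift
`y` below `N - c'` to a compatible `x` (hLift), so `π^r pr x` vanishes at level `N - c'` and is `π^{N-c'} h` (hE); by
(hF2) + Kőnig pick a compatible `x₁` with `pr x₁ = π^{N-c'-r-1} h`; then `s = x - π x₁` has `π^r pr s = 0`, so `s` is
saturated (hSat), and `fH N 1 y = fH N 1 (s N)` by (hπ1).  One correction step, no case distinction; this is the
tower-algebra half of the cell's uniform proof of H.5(b) at `v ∣ p` (anomalous or not): on the level `T/p = E[p] ⊗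
A_{m,1}(ψ)` the Iwasawa involution `ι` identifies the cut for `ψ` with the cut for `ψ⁻¹`.  Everything here is [folklore]
bookkeeping recorded against Howard §3.1–3.2; seat `bsd-line-x9-p1-w3` g6.  No summit statement is proved; BSD is not
proved by any of this.

References: [Howard2004HeegnerKolyvagin] Def. 1.1.3, §1.3 H.5(b), Def. 3.1.2, §3.1, Lemma 3.2.7 (arXiv:1202.6340 p. 5,
p. 7 L96–97, p. 15 L56–66 and L99–108, p. 16 L142–160); [MazurRubinMemoirs2004] Def. 1.1.1, Example 1.1.2;
[SerreGaloisCohomology1997] I §2.2; [NeukirchSchmidtWingberg2008] Cor. 2.7.6.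
-/

set_option autoImplicit false

noncomputable section

universe u

namespace Literature.NumberTheory.EllipticCurves

namespace Tower

variable {H : ℕ → Type u} [∀ j, AddCommGroup (H j)] {G : ℕ → Type u} [∀ j, AddCommGroup (G j)]
  (fH : ∀ a b, H a →+ H b) (fG : ∀ a b, G a →+ G b) (pr : ∀ j, H j →+ G j)
  (πH : ∀ j, AddMonoid.End (H j)) (πG : ∀ j, AddMonoid.End (G j))

/-! ## §1 Bookkeeping: two-index families, iterated endomorphisms -/

/-- For a compatible family of the tower `red j = f (j+1) j` of a two-index family with `f a a = id` and
`f b c ∘ f a b = f a c` (`c ≤ b ≤ a`), the reduction `f a b` (`b ≤ a`) sends the `a`-component to the `b`-component.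
[cite: SerreGaloisCohomology1997, Ch. I §2.2 (inverse limits)] -/
theorem apply_eq_of_mem_compatibleFamilies (hid : ∀ a (x : H a), fH a a x = x)
    (hcomp : ∀ a b c, c ≤ b → b ≤ a → ∀ x : H a, fH b c (fH a b x) = fH a c x) {x : Π j, H j}
    (hx : x ∈ compatibleFamilies (fun j ↦ fH (j + 1) j)) {a b : ℕ} (hba : b ≤ a) : fH a b (x a) = x b := by
  obtain ⟨d, rfl⟩ := Nat.exists_eq_add_of_le hba
  induction d with
  | zero => simpa using hid b (x b)
  | succ d ih =>
    have hstep : fH (b + (d + 1)) (b + d) (x (b + (d + 1))) = x (b + d) :=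
      (mem_compatibleFamilies_iff _ x).mp hx (b + d)
    rw [← hcomp (b + (d + 1)) (b + d) b (Nat.le_add_right b d) (by omega), hstep]
    exact ih (Nat.le_add_right b d)

/-- `(e ^ (n+1)) x = (e ^ n) (e x)` in the endomorphism monoid (the `S_𝔮`-scalars acting on cohomology).
[cite: Howard2004HeegnerKolyvagin, §2.2 (T_𝔮 is an S_𝔮[G_K]-module; arXiv p. 12)] -/
theorem endPow_succ_apply {A : Type u} [AddCommGroup A] (e : AddMonoid.End A) (n : ℕ) (x : A) :
    (e ^ (n + 1)) x = (e ^ n) (e x) := by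
  rw [pow_succ, AddMonoid.End.coe_mul, Function.comp_apply]

/-- `(e ^ (n+1)) x = e ((e ^ n) x)` in the endomorphism monoid (the `S_𝔮`-scalars acting on cohomology).
[cite: Howard2004HeegnerKolyvagin, §2.2 (T_𝔮 is an S_𝔮[G_K]-module; arXiv p. 12)] -/
theorem endPow_succ_apply' {A : Type u} [AddCommGroup A] (e : AddMonoid.End A) (n : ℕ) (x : A) :
    (e ^ (n + 1)) x = e ((e ^ n) x) := by
  rw [pow_succ', AddMonoid.End.coe_mul, Function.comp_apply]

/-- `(e ^ (m+n)) x = (e ^ m) ((e ^ n) x)` in the endomorphism monoid (the `S_𝔮`-scalars acting on cohomology).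
[cite: Howard2004HeegnerKolyvagin, §2.2 (T_𝔮 is an S_𝔮[G_K]-module; arXiv p. 12)] -/
theorem endPow_add_apply {A : Type u} [AddCommGroup A] (e : AddMonoid.End A) (m n : ℕ) (x : A) :
    (e ^ (m + n)) x = (e ^ m) ((e ^ n) x) := by
  rw [pow_add, AddMonoid.End.coe_mul, Function.comp_apply]

/-- Powers of endomorphisms intertwined by an additive map are intertwined by it.
[cite: Howard2004HeegnerKolyvagin, §2.2 (T_𝔮 is an S_𝔮[G_K]-module; arXiv p. 12)] [folklore] -/
theorem pow_apply_comm_of_comm {A B : Type u} [AddCommGroup A] [AddCommGroup B] (g : A →+ B) (eA : AddMonoid.End A)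
    (eB : AddMonoid.End B) (h : ∀ x, g (eA x) = eB (g x)) (n : ℕ) (x : A) : g ((eA ^ n) x) = (eB ^ n) (g x) := by
  induction n generalizing x with
  | zero => rw [pow_zero, pow_zero, AddMonoid.End.one_apply, AddMonoid.End.one_apply]
  | succ n ih => rw [endPow_succ_apply, endPow_succ_apply, ih, h]

/-- Applying a power of a levelwise endomorphism system compatible with the reductions to a compatible family gives a
compatible family. [cite: Howard2004HeegnerKolyvagin, §1.6 and §2.2 (arXiv p. 12)] [folklore] -/
theorem pow_map_mem_compatibleFamilies (hπ : ∀ j (y : H (j + 1)), fH (j + 1) j (πH (j + 1) y) = πH j (fH (j + 1) j y))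
    (n : ℕ) {x : Π j, H j} (hx : x ∈ compatibleFamilies (fun j ↦ fH (j + 1) j)) :
    (fun j ↦ (πH j ^ n) (x j)) ∈ compatibleFamilies (fun j ↦ fH (j + 1) j) :=
  map_mem_compatibleFamilies (fun j ↦ fH (j + 1) j) (fun j ↦ πH j ^ n)
    (fun j y ↦ pow_apply_comm_of_comm (fH (j + 1) j) (πH (j + 1)) (πH j) (hπ j) n y) hx

/-- The levelwise projection of a compatible family is a compatible family.
[cite: Howard2004HeegnerKolyvagin, Def. 3.2.5 (arXiv p. 16: gr_v compatible with the tower)] [folklore] -/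
theorem pr_mem_compatibleFamilies (hpr : ∀ j (x : H (j + 1)), pr j (fH (j + 1) j x) = fG (j + 1) j (pr (j + 1) x))
    {x : Π j, H j} (hx : x ∈ compatibleFamilies (fun j ↦ fH (j + 1) j)) :
    (fun j ↦ pr j (x j)) ∈ compatibleFamilies (fun j ↦ fG (j + 1) j) := by
  rw [mem_compatibleFamilies_iff] at hx ⊢
  intro j
  rw [← hpr, hx]

/-! ## §2 The torsion cut -/

/-- **The torsion cut** `{y ∈ H_N | π^r (pr_N y) = 0}` of level `N` — the kernel of `π^r ∘ pr_N` (the classes whose image in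
`H¹(K_v, gr (T/π^N))` is killed by `π^r`).  Recorded as the kernel of an additive map, no new definition.
[cite: Howard2004HeegnerKolyvagin, Lemma 3.2.7 (arXiv p. 16 L150–160: the saturation is controlled by π-power torsion)] -/
theorem mem_comap_ker_pow_iff (N r : ℕ) (y : H N) :
    y ∈ (AddMonoidHom.ker (πG N ^ r)).comap (pr N) ↔ (πG N ^ r) (pr N y) = 0 :=
  Iff.rfl

/-! ## §3 `⊆`: a saturated family lies in the torsion cut -/

/-- **The `N`-th component of a saturated family lies in the torsion cut**, given (hTor): a compatible family of `G` killed by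
a power of `p` is killed levelwise by `π^r`. [cite: Howard2004HeegnerKolyvagin, Def. 3.1.2 and Lemma 3.2.7 (arXiv p. 15 L99–108, p. 16)] -/
theorem pow_pr_apply_eq_zero_of_mem_saturatedFamilies
    (hpr : ∀ j (x : H (j + 1)), pr j (fH (j + 1) j x) = fG (j + 1) j (pr (j + 1) x)) (p r : ℕ)
    (hTor : ∀ w ∈ compatibleFamilies (fun j ↦ fG (j + 1) j), ∀ a : ℕ, (∀ j, p ^ a • w j = 0) → ∀ j, (πG j ^ r) (w j) = 0)
    {x : Π j, H j} (hx : x ∈ saturatedFamilies (fun j ↦ fH (j + 1) j) p (fun j ↦ (pr j).ker)) (N : ℕ) :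
    (πG N ^ r) (pr N (x N)) = 0 := by
  obtain ⟨hxc, a, ha⟩ := hx
  refine hTor (fun j ↦ pr j (x j)) (pr_mem_compatibleFamilies fH fG pr hpr hxc) a (fun j ↦ ?_) N
  have h := ha j
  rw [AddMonoidHom.mem_ker, map_nsmul] at h
  exact h

/-- `⊆` of the main theorem: the image of the level condition lies in the image of the torsion cut (under ANY additive map
out of `H_N`). [cite: Howard2004HeegnerKolyvagin, Def. 3.1.2 and Lemma 3.2.7 (arXiv p. 15–16)] -/
theorem map_levelCondition_le_map_torsionCut (p r N : ℕ) {Z : Type u} [AddCommGroup Z] (ρ : H N →+ Z)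
    (hpr : ∀ j (x : H (j + 1)), pr j (fH (j + 1) j x) = fG (j + 1) j (pr (j + 1) x))
    (hTor : ∀ w ∈ compatibleFamilies (fun j ↦ fG (j + 1) j), ∀ a : ℕ, (∀ j, p ^ a • w j = 0) → ∀ j, (πG j ^ r) (w j) = 0) :
    (levelCondition (fun j ↦ fH (j + 1) j) p (fun j ↦ (pr j).ker) N).map ρ ≤
      ((AddMonoidHom.ker (πG N ^ r)).comap (pr N)).map ρ := by
  rintro _ ⟨y, hy, rfl⟩
  obtain ⟨x, hx, rfl⟩ := (mem_levelCondition_iff _ p _ N y).mp hy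
  exact ⟨x N, (mem_comap_ker_pow_iff pr πG N r (x N)).mpr
    (pow_pr_apply_eq_zero_of_mem_saturatedFamilies fH fG pr πG hpr p r hTor hx N), rfl⟩

/-! ## §4 `⊇`: a class of the torsion cut is residually a saturated class -/

/-- **Kőnig for (hF2)**: if every `π^c w` (`w ∈ G_j`) is a `pr_j z`, then for a compatible family `u` of `G` there is a
compatible family `x₁` of `H` with `pr x₁ = π^c u` levelwise (towers of finite groups).
[cite: Howard2004HeegnerKolyvagin, Lemma 3.2.7 (arXiv p. 16 L142–160)] [cite: NeukirchSchmidtWingberg2008, Cor. 2.7.6] -/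
theorem exists_mem_compatibleFamilies_pr_eq_pow [∀ j, Finite (H j)]
    (hpr : ∀ j (x : H (j + 1)), pr j (fH (j + 1) j x) = fG (j + 1) j (pr (j + 1) x))
    (hπG : ∀ j (w : G (j + 1)), fG (j + 1) j (πG (j + 1) w) = πG j (fG (j + 1) j w)) (c : ℕ)
    (hF2 : ∀ j (w : G j), ∃ z : H j, pr j z = (πG j ^ c) w)
    {u : Π j, G j} (hu : u ∈ compatibleFamilies (fun j ↦ fG (j + 1) j)) :
    ∃ x₁ ∈ compatibleFamilies (fun j ↦ fH (j + 1) j), ∀ j, pr j (x₁ j) = (πG j ^ c) (u j) := by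
  have hne : ∀ j, ({z : H j | pr j z = (πG j ^ c) (u j)} : Set (H j)).Nonempty := fun j ↦ by
    obtain ⟨z, hz⟩ := hF2 j (u j)
    exact ⟨z, hz⟩
  have hst : ∀ j, ∀ z ∈ ({z : H (j + 1) | pr (j + 1) z = (πG (j + 1) ^ c) (u (j + 1))} : Set (H (j + 1))),
      fH (j + 1) j z ∈ ({z : H j | pr j z = (πG j ^ c) (u j)} : Set (H j)) := by
    intro j z hz
    change pr (j + 1) z = (πG (j + 1) ^ c) (u (j + 1)) at hz
    change pr j (fH (j + 1) j z) = (πG j ^ c) (u j)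
    rw [hpr, hz, pow_apply_comm_of_comm (fG (j + 1) j) (πG (j + 1)) (πG j) (hπG j) c,
      (mem_compatibleFamilies_iff _ u).mp hu j]
  obtain ⟨x₁, hx₁, hS⟩ := exists_mem_compatibleFamilies_of_forall_mem (fun j ↦ fH (j + 1) j)
    (fun j ↦ {z : H j | pr j z = (πG j ^ c) (u j)}) hne hst
  exact ⟨x₁, hx₁, fun j ↦ hS j⟩

/-- **The main theorem, `⊇` half.**  Under (hπ1), (hSat), (hE), (hF2), (hLift) and `r + c + c' + 1 ≤ N` (see the module
docstring), every class of the torsion cut of level `N` has the same image in `H_1` as the `N`-th component of a saturated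
family. [cite: Howard2004HeegnerKolyvagin, §1.3 H.5(b), Def. 3.1.2, §3.1 and Lemma 3.2.7 (arXiv p. 7 L96–97, p. 15 L99–108, p. 16 L142–160)]
[cite: MazurRubinMemoirs2004, Def. 1.1.1 and Example 1.1.2] -/
theorem map_torsionCut_le_map_levelCondition [∀ j, Finite (H j)]
    (hidH : ∀ a (x : H a), fH a a x = x)
    (hcompH : ∀ a b c, c ≤ b → b ≤ a → ∀ x : H a, fH b c (fH a b x) = fH a c x)
    (hpr : ∀ a b, b ≤ a → ∀ x : H a, pr b (fH a b x) = fG a b (pr a x))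
    (hπH : ∀ a b, b ≤ a → ∀ x : H a, fH a b (πH a x) = πH b (fH a b x))
    (hπG : ∀ a b, b ≤ a → ∀ w : G a, fG a b (πG a w) = πG b (fG a b w))
    (hprπ : ∀ j (x : H j), pr j (πH j x) = πG j (pr j x))
    (p : ℕ) {N r c c' : ℕ} (hN : r + c + c' + 1 ≤ N)
    (hπ1 : ∀ x : H 1, πH 1 x = 0)
    (hSat : ∀ x ∈ compatibleFamilies (fun j ↦ fH (j + 1) j), (∀ j, (πG j ^ r) (pr j (x j)) = 0) →
      x ∈ saturatedFamilies (fun j ↦ fH (j + 1) j) p (fun j ↦ (pr j).ker))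
    (hE : ∀ w ∈ compatibleFamilies (fun j ↦ fG (j + 1) j), ∀ k, w k = 0 →
      ∃ h ∈ compatibleFamilies (fun j ↦ fG (j + 1) j), ∀ j, k ≤ j → w j = (πG j ^ k) (h j))
    (hF2 : ∀ j (w : G j), ∃ z : H j, pr j z = (πG j ^ c) w)
    (hLift : ∀ y : H N, ∃ x ∈ compatibleFamilies (fun j ↦ fH (j + 1) j), fH N (N - c') (x N) = fH N (N - c') y) :
    ((AddMonoidHom.ker (πG N ^ r)).comap (pr N)).map (fH N 1) ≤
      (levelCondition (fun j ↦ fH (j + 1) j) p (fun j ↦ (pr j).ker) N).map (fH N 1) := by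
  rintro _ ⟨y, hy, rfl⟩
  have hy' : (πG N ^ r) (pr N y) = 0 := (mem_comap_ker_pow_iff pr πG N r y).mp hy
  have hsub : N - c' ≤ N := Nat.sub_le N c'
  have h1N : 1 ≤ N - c' := by omega
  -- (hLift): a compatible `x` agreeing with `y` below level `N - c'`
  obtain ⟨x, hx, hxy⟩ := hLift y
  -- the compatible family `w = π^r pr x` of `G` vanishes at level `N - c'`
  have hprx : (fun j ↦ pr j (x j)) ∈ compatibleFamilies (fun j ↦ fG (j + 1) j) :=
    pr_mem_compatibleFamilies fH fG pr (fun j z ↦ hpr (j + 1) j (Nat.le_succ j) z) hx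
  have hw : (fun j ↦ (πG j ^ r) (pr j (x j))) ∈ compatibleFamilies (fun j ↦ fG (j + 1) j) :=
    pow_map_mem_compatibleFamilies fG πG (fun j z ↦ hπG (j + 1) j (Nat.le_succ j) z) r hprx
  have hwN : (fun j ↦ (πG j ^ r) (pr j (x j))) (N - c') = 0 := by
    have hxN : x (N - c') = fH N (N - c') (x N) :=
      (apply_eq_of_mem_compatibleFamilies fH hidH hcompH hx hsub).symm
    change (πG (N - c') ^ r) (pr (N - c') (x (N - c'))) = 0
    rw [hxN, hxy, hpr N (N - c') hsub,
      ← pow_apply_comm_of_comm (fG N (N - c')) (πG N) (πG (N - c')) (hπG N (N - c') hsub) r, hy', map_zero]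
  -- (hE): `π^r pr x = π^{N-c'} h` from level `N - c'` on
  obtain ⟨h, hh, hwh⟩ := hE _ hw (N - c') hwN
  -- (hF2) + Kőnig: a compatible `x₁` with `pr x₁ = π^{N - c' - r - 1} h`
  obtain ⟨d, hd⟩ : ∃ d, N - c' - r - 1 = c + d := ⟨N - c' - r - 1 - c, by omega⟩
  have hu : (fun j ↦ (πG j ^ d) (h j)) ∈ compatibleFamilies (fun j ↦ fG (j + 1) j) :=
    pow_map_mem_compatibleFamilies fG πG (fun j z ↦ hπG (j + 1) j (Nat.le_succ j) z) d hh
  obtain ⟨x₁, hx₁, hx₁pr⟩ := exists_mem_compatibleFamilies_pr_eq_pow fH fG pr πG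
    (fun j z ↦ hpr (j + 1) j (Nat.le_succ j) z) (fun j z ↦ hπG (j + 1) j (Nat.le_succ j) z) c hF2 hu
  have hx₁pr' : ∀ j, pr j (x₁ j) = (πG j ^ (N - c' - r - 1)) (h j) := fun j ↦ by
    rw [hx₁pr j, hd]
    exact (endPow_add_apply (πG j) c d (h j)).symm
  -- the corrected family `s = x - π x₁` is compatible
  have hπx₁ : (fun j ↦ πH j (x₁ j)) ∈ compatibleFamilies (fun j ↦ fH (j + 1) j) :=
    map_mem_compatibleFamilies (fun j ↦ fH (j + 1) j) (fun j ↦ πH j)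
      (fun j z ↦ hπH (j + 1) j (Nat.le_succ j) z) hx₁
  have hs : (fun j ↦ x j - πH j (x₁ j)) ∈ compatibleFamilies (fun j ↦ fH (j + 1) j) := sub_mem hx hπx₁
  -- the compatible family `π^r pr x - π^{N-c'} h` vanishes from level `N - c'` on, hence everywhere
  have hv : (fun j ↦ (πG j ^ r) (pr j (x j)) - (πG j ^ (N - c')) (h j)) ∈ compatibleFamilies (fun j ↦ fG (j + 1) j) :=
    sub_mem hw (pow_map_mem_compatibleFamilies fG πG (fun j z ↦ hπG (j + 1) j (Nat.le_succ j) z) (N - c') hh)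
  have hv0 : ∀ j, (πG j ^ r) (pr j (x j)) - (πG j ^ (N - c')) (h j) = 0 := by
    intro j
    by_cases hj : N - c' ≤ j
    · exact sub_eq_zero.mpr (hwh j hj)
    · have hzero : (fun j ↦ (πG j ^ r) (pr j (x j)) - (πG j ^ (N - c')) (h j)) (N - c') = 0 :=
        sub_eq_zero.mpr (hwh (N - c') le_rfl)
      exact apply_eq_zero_of_apply_eq_zero_of_le (fun j ↦ fG (j + 1) j) hv hzero (le_of_lt (not_le.mp hj))
  -- hence `π^r pr s = 0` and `s` is saturated
  have hsr : ∀ j, (πG j ^ r) (pr j ((fun j ↦ x j - πH j (x₁ j)) j)) = 0 := by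
    intro j
    have hrN : r + 1 + (N - c' - r - 1) = N - c' := by omega
    have e2 : (πG j ^ r) (πG j ((πG j ^ (N - c' - r - 1)) (h j))) = (πG j ^ (N - c')) (h j) := by
      rw [← endPow_succ_apply, ← endPow_add_apply, hrN]
    change (πG j ^ r) (pr j (x j - πH j (x₁ j))) = 0
    rw [map_sub, hprπ, hx₁pr', map_sub, e2]
    exact hv0 j
  have hsat : (fun j ↦ x j - πH j (x₁ j)) ∈ saturatedFamilies (fun j ↦ fH (j + 1) j) p (fun j ↦ (pr j).ker) :=
    hSat _ hs hsr
  -- read at level `1`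
  refine ⟨x N - πH N (x₁ N), (mem_levelCondition_iff _ p _ N _).mpr ⟨_, hsat, rfl⟩, ?_⟩
  have hyN : fH N 1 y = fH N 1 (x N) := by
    rw [← hcompH N (N - c') 1 h1N hsub y, ← hcompH N (N - c') 1 h1N hsub (x N), hxy]
  rw [hyN, map_sub, hπH N 1 (by omega) (x₁ N), hπ1, sub_zero]

/-- **The residual image of the saturated level condition is the residual image of the torsion cut**:
`(levelCondition red p C N).map (fH N 1) = {y ∈ H_N | π^r (pr_N y) = 0}.map (fH N 1)` under the hypotheses of the module
docstring — Howard's `F_𝔮` at `v ∣ p` propagated to the residual level is determined inside the single level `T/π^N`.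
[cite: Howard2004HeegnerKolyvagin, §1.3 H.5(b), Def. 3.1.2, §3.1 and Lemma 3.2.7 (arXiv:1202.6340 p. 7 L96–97, p. 15 L99–108, p. 16 L142–160)]
[cite: MazurRubinMemoirs2004, Def. 1.1.1 and Example 1.1.2] [cite: SerreGaloisCohomology1997, Ch. I §2.2] -/
theorem map_levelCondition_eq_map_torsionCut [∀ j, Finite (H j)]
    (hidH : ∀ a (x : H a), fH a a x = x)
    (hcompH : ∀ a b c, c ≤ b → b ≤ a → ∀ x : H a, fH b c (fH a b x) = fH a c x)
    (hpr : ∀ a b, b ≤ a → ∀ x : H a, pr b (fH a b x) = fG a b (pr a x))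
    (hπH : ∀ a b, b ≤ a → ∀ x : H a, fH a b (πH a x) = πH b (fH a b x))
    (hπG : ∀ a b, b ≤ a → ∀ w : G a, fG a b (πG a w) = πG b (fG a b w))
    (hprπ : ∀ j (x : H j), pr j (πH j x) = πG j (pr j x))
    (p : ℕ) {N r c c' : ℕ} (hN : r + c + c' + 1 ≤ N)
    (hπ1 : ∀ x : H 1, πH 1 x = 0)
    (hTor : ∀ w ∈ compatibleFamilies (fun j ↦ fG (j + 1) j), ∀ a : ℕ, (∀ j, p ^ a • w j = 0) → ∀ j, (πG j ^ r) (w j) = 0)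
    (hSat : ∀ x ∈ compatibleFamilies (fun j ↦ fH (j + 1) j), (∀ j, (πG j ^ r) (pr j (x j)) = 0) →
      x ∈ saturatedFamilies (fun j ↦ fH (j + 1) j) p (fun j ↦ (pr j).ker))
    (hE : ∀ w ∈ compatibleFamilies (fun j ↦ fG (j + 1) j), ∀ k, w k = 0 →
      ∃ h ∈ compatibleFamilies (fun j ↦ fG (j + 1) j), ∀ j, k ≤ j → w j = (πG j ^ k) (h j))
    (hF2 : ∀ j (w : G j), ∃ z : H j, pr j z = (πG j ^ c) w)
    (hLift : ∀ y : H N, ∃ x ∈ compatibleFamilies (fun j ↦ fH (j + 1) j), fH N (N - c') (x N) = fH N (N - c') y) :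
    (levelCondition (fun j ↦ fH (j + 1) j) p (fun j ↦ (pr j).ker) N).map (fH N 1) =
      ((AddMonoidHom.ker (πG N ^ r)).comap (pr N)).map (fH N 1) :=
  le_antisymm
    (map_levelCondition_le_map_torsionCut fH fG pr πG p r N (fH N 1) (fun j z ↦ hpr (j + 1) j (Nat.le_succ j) z) hTor)
    (map_torsionCut_le_map_levelCondition fH fG pr πH πG hidH hcompH hpr hπH hπG hprπ p hN hπ1 hSat hE hF2 hLift)

end Tower

end Literature.NumberTheory.EllipticCurves

end
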